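import Summits.AtomisticToContinuum.Crystallization.Theorems.FrustratedLawDichotomyStrainedPatchHomValueT2Kit

/-!
# (I1) part D — soundness of the CERTIFIED BOX MINIMUM of the quadratic model (`…HomValueT2Kit.boxMin`): `segMin` over the reals, the fold-to-sum
# bookkeeping, the anchor identity `q(x) = q(t⋆) + a·(x − t⋆) + ½ (x − t⋆)ᵀH(x − t⋆)`, the PSD shift through `qfN_nonneg_of_psdTestN` (p854168)
# (27623 `(H) HomFloor`, hcp half; decomp-a2c hand-1 g41; FINDING-hand-1-g41 §6 (R4); edition-independent: every edition's `LB` uses `boxMin`).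

★ `boxMin_le`: for a symmetric `Hc`, a shift `κ` with `psdTestN 9 (shiftedK Hc κ) = true`, ANY anchor array `t`, and every real point `x` of the box
`|x_k| ≤ w_k/SC`:  `boxMin Hc gc wf κ t / SC ≤ Σ_k (gc_k/SC) x_k + ½ Σ_{k,l} (Hc_kl/SC) x_k x_l`.
No definitions; 0 sorry; standard axioms; no instances / notation / `#eval`.  `--supports stmt-AtomisticToContinuum-27623`.
-/

noncomputable section

namespace Summit.AtomisticToContinuum.Crystallization.Theorems.FrustratedLawDichotomyStrainedPatchHomValueT2Kit

open scoped BigOperators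
open Finset
open Literature.Analysis.ValidatedNumerics.Numerics
open Summit.AtomisticToContinuum.Crystallization.Theorems.FrustratedLawDichotomyStrainedPatchHomHertzN (psdTestN qfN qfN_nonneg_of_psdTestN)

/-! ## §1. Folds are sums -/

/-- A left fold of `s + f k` over `List.range n` is the `Finset.range` sum. [formal bookkeeping] -/
theorem foldl_add_range (f : ℕ → ℤ) (n : ℕ) (a : ℤ) :
    (List.range n).foldl (fun s k => s + f k) a = a + ∑ k ∈ range n, f k := by
  induction n generalizing a with
  | zero => simp
  | succ n ih => rw [List.range_succ, List.foldl_append, ih, sum_range_succ]; simp [add_assoc]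

/-- `hMul Hc t k = Σ_{l<9} Hc_kl t_l`. [formal bookkeeping] -/
theorem hMul_eq_sum (Hc t : Array ℤ) (k : ℕ) : hMul Hc t k = ∑ l ∈ range 9, get81 Hc k l * t.getD l 0 := by
  unfold hMul; rw [foldl_add_range]; simp

/-! ## §2. `segMin` over the reals -/

/-- ★ `segMin A D lo hi ≤ 2As + Ds²` for every REAL `s ∈ [lo, hi]`. [folklore: vertex inside ⟹ `−A²/D`; else an end point of a monotone/concave piece] -/
theorem segMin_le {A D lo hi : ℤ} {s : ℝ} (hlo : (lo : ℝ) ≤ s) (hhi : s ≤ hi) :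
    ((segMin A D lo hi : ℤ) : ℝ) ≤ 2 * A * s + D * s ^ 2 := by
  unfold segMin
  split_ifs with h
  · -- interior vertex, `D > 0`
    obtain ⟨hD, _, _⟩ := h
    have hDr : (0 : ℝ) < D := by exact_mod_cast hD
    have hc : ((A * A : ℤ) : ℝ) / D ≤ ((cdiv (A * A) D : ℤ) : ℝ) := div_le_cdiv hD
    have key : -(((A : ℝ) * A) / D) ≤ 2 * A * s + D * s ^ 2 := by
      have : 2 * (A : ℝ) * s + D * s ^ 2 + (A : ℝ) * A / D = D * (s + A / D) ^ 2 := by field_simp; ring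
      nlinarith [mul_nonneg hDr.le (sq_nonneg (s + (A : ℝ) / D))]
    push_cast at hc ⊢
    linarith
  · -- an end point
    push_cast
    -- the quadratic `φ(s) = 2As + Ds²` on `[lo, hi]` attains its minimum at an end point unless `D > 0` with the vertex inside
    by_cases hD : (0 : ℤ) < D
    · have hDr : (0 : ℝ) < D := by exact_mod_cast hD
      -- vertex `−A/D` outside `[lo, hi]` (integers compared exactly): either `−A < lo·D` or `hi·D < −A`
      have hout : ¬((lo : ℤ) * D ≤ -A ∧ -A ≤ hi * D) := fun hh => h ⟨hD, hh.1, hh.2⟩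
      rcases not_and_or.mp hout with h1 | h1
      · -- `lo·D > −A`: φ increasing on `[lo, hi]` ⟹ `φ(lo) ≤ φ(s)`
        have h1' : -(A : ℝ) < lo * D := by exact_mod_cast (not_le.mp h1)
        refine (min_le_left _ _).trans ?_
        have : (2 * (A : ℝ) * s + D * s ^ 2) - (2 * A * lo + D * lo * lo) = (s - lo) * (2 * A + D * (s + lo)) := by ring
        nlinarith [mul_nonneg (sub_nonneg.2 hlo) (show (0:ℝ) ≤ 2 * A + D * (s + lo) by nlinarith)]
      · have h1' : (hi : ℝ) * D < -A := by exact_mod_cast (not_le.mp h1)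
        refine (min_le_right _ _).trans ?_
        have : (2 * (A : ℝ) * s + D * s ^ 2) - (2 * A * hi + D * hi * hi) = (hi - s) * (-(2 * A + D * (s + hi))) := by ring
        nlinarith [mul_nonneg (sub_nonneg.2 hhi) (show (0:ℝ) ≤ -(2 * A + D * (s + hi)) by nlinarith)]
    · -- `D ≤ 0`: concave ⟹ minimum at an end point
      have hDr : (D : ℝ) ≤ 0 := by exact_mod_cast (not_lt.mp hD)
      -- φ(s) ≥ min(φ lo, φ hi) by concavity: φ(s) − [(hi−s)φ(lo) + (s−lo)φ(hi)]/(hi−lo) = −D (s−lo)(hi−s) ≥ 0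
      by_cases hle : 2 * (A : ℝ) * lo + D * lo * lo ≤ 2 * A * hi + D * hi * hi
      · refine (min_le_left _ _).trans ?_
        have : (2 * (A : ℝ) * s + D * s ^ 2) - (2 * A * lo + D * lo * lo) = (s - lo) * (2 * A + D * (s + lo)) := by ring
        -- `2A + D(s+lo) ≥ 2A + D(hi+lo) ≥ 0` from `hle` and `D ≤ 0`
        have hge : (0 : ℝ) ≤ (2 * A + D * (hi + lo)) * (hi - lo) := by nlinarith
        rcases eq_or_lt_of_le (hlo.trans hhi) with heq | hlt
        · have : s = lo := le_antisymm (heq ▸ hhi) hlo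
          subst this; simp [sq]; ring_nf; rfl
        · have hpos : (0 : ℝ) < hi - lo := sub_pos.2 hlt
          have h2 : (0 : ℝ) ≤ 2 * A + D * (hi + lo) := nonneg_of_mul_nonneg_left (by linarith) hpos
          nlinarith [mul_nonneg (sub_nonneg.2 hlo) (show (0:ℝ) ≤ 2 * A + D * (s + lo) by nlinarith [mul_le_mul_of_nonpos_left (add_le_add_right hhi lo) hDr])]
      · refine (min_le_right _ _).trans ?_
        have hle' : 2 * (A : ℝ) * hi + D * hi * hi ≤ 2 * A * lo + D * lo * lo := (not_le.mp hle).le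
        rcases eq_or_lt_of_le (hlo.trans hhi) with heq | hlt
        · have : s = hi := le_antisymm hhi (heq ▸ hlo)
          subst this; simp [sq]; ring_nf; rfl
        · have hpos : (0 : ℝ) < hi - lo := sub_pos.2 hlt
          have hge : (0 : ℝ) ≤ -(2 * A + D * (hi + lo)) * (hi - lo) := by nlinarith
          have h2 : (0 : ℝ) ≤ -(2 * A + D * (hi + lo)) := nonneg_of_mul_nonneg_left (by linarith) hpos
          nlinarith [mul_nonneg (sub_nonneg.2 hhi) (show (0:ℝ) ≤ -(2 * A + D * (s + hi)) by nlinarith [mul_le_mul_of_nonpos_left (add_le_add_right hlo hi) hDr])]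

/-! ## §3. ★ The box minimum -/

/-- The integer `q2` fold of `boxMin` as a sum. [formal bookkeeping] -/
theorem q2_eq_sum (Hc gc t : Array ℤ) :
    (List.range 9).foldl (fun s k => s + 2 * (SC : ℤ) * gc.getD k 0 * t.getD k 0 + t.getD k 0 * hMul Hc t k) 0 =
      ∑ k ∈ range 9, (2 * (SC : ℤ) * gc.getD k 0 * t.getD k 0 + t.getD k 0 * hMul Hc t k) := by
  have := foldl_add_range (fun k => 2 * (SC : ℤ) * gc.getD k 0 * t.getD k 0 + t.getD k 0 * hMul Hc t k) 9 0
  simp only [zero_add] at this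
  rw [← this]
  congr 1
  funext s k
  ring

/-- The integer `m2` fold of `boxMin` as a sum. [formal bookkeeping] -/
theorem m2_eq_sum (Hc gc wf t : Array ℤ) (κ : ℤ) :
    (List.range 9).foldl (fun s k =>
      let A := (SC : ℤ) * gc.getD k 0 + hMul Hc t k
      let w := wf.getD k 0
      let tk := t.getD k 0
      s + segMin A (-κ) (-w - tk) (w - tk)) 0 =
      ∑ k ∈ range 9, segMin ((SC : ℤ) * gc.getD k 0 + hMul Hc t k) (-κ) (-wf.getD k 0 - t.getD k 0) (wf.getD k 0 - t.getD k 0) := by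
  have := foldl_add_range (fun k => segMin ((SC : ℤ) * gc.getD k 0 + hMul Hc t k) (-κ) (-wf.getD k 0 - t.getD k 0) (wf.getD k 0 - t.getD k 0)) 9 0
  simp only [zero_add] at this
  exact this

/-- The PSD certificate of the shifted matrix, read on `range 9` sums. [formal bookkeeping] -/
theorem shifted_form_nonneg {Hc : Array ℤ} {κ : ℤ} (hsym : ∀ k l : Fin 9, get81 Hc k.val l.val = get81 Hc l.val k.val)
    (hpsd : psdTestN 9 (shiftedK Hc κ) = true) (s : ℕ → ℝ) :
    0 ≤ ∑ k ∈ range 9, ∑ l ∈ range 9, ((get81 Hc k l : ℝ) + (if k = l then (κ : ℝ) else 0)) * (s k * s l) := by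
  have hM : ∀ i j : Fin 9, shiftedK Hc κ i j = shiftedK Hc κ j i := by
    intro i j
    unfold shiftedK
    rw [hsym i j]
    by_cases h : i = j
    · subst h; rfl
    · rw [if_neg h, if_neg (Ne.symm h)]
  have key := qfN_nonneg_of_psdTestN 9 (shiftedK Hc κ) hM hpsd (fun i => s i.val)
  unfold qfN shiftedK at key
  rw [Finset.sum_range (fun k => ∑ l ∈ range 9, ((get81 Hc k l : ℝ) + (if k = l then (κ : ℝ) else 0)) * (s k * s l))]
  refine le_of_le_of_eq key (Finset.sum_congr rfl fun i _ => ?_)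
  rw [Finset.sum_range (fun l => ((get81 Hc i.val l : ℝ) + (if i.val = l then (κ : ℝ) else 0)) * (s i.val * s l))]
  refine Finset.sum_congr rfl fun j _ => ?_
  have : ((i = j) ↔ (i.val = j.val)) := Fin.ext_iff
  by_cases h : i = j
  · rw [if_pos h, if_pos (this.mp h)]; push_cast; ring
  · rw [if_neg h, if_neg (fun e => h (this.mpr e))]; push_cast; ring

/-- `hMul` read over the reals. [formal bookkeeping] -/
theorem hMul_cast (Hc t : Array ℤ) (k : ℕ) :
    ((hMul Hc t k : ℤ) : ℝ) = ∑ l ∈ range 9, (get81 Hc k l : ℝ) * (t.getD l 0 : ℝ) := by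
  rw [hMul_eq_sum]; push_cast; rfl

/-- ★★★ **SOUNDNESS OF THE BOX MINIMUM**: for a symmetric centre matrix, a PSD-certified shift `κ` and ANY anchor `t`, every point `x` of the box satisfies
`boxMin/SC ≤ g·x + ½ xᵀHx` (all data read in `SC` units). [folklore: anchor identity + PSD shift + `segMin_le` + floor division] -/
theorem boxMin_le (Hc gc wf t : Array ℤ) (κ : ℤ) (hsym : ∀ k l : Fin 9, get81 Hc k.val l.val = get81 Hc l.val k.val)
    (hpsd : psdTestN 9 (shiftedK Hc κ) = true) (x : ℕ → ℝ) (hx : ∀ k, k < 9 → |x k| ≤ (wf.getD k 0 : ℝ) / SC) :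
    ((boxMin Hc gc wf κ t : ℤ) : ℝ) / SC ≤
      ∑ k ∈ range 9, (gc.getD k 0 : ℝ) / SC * x k + 1 / 2 * ∑ k ∈ range 9, ∑ l ∈ range 9, (get81 Hc k l : ℝ) / SC * (x k * x l) := by
  have hS : (0 : ℝ) < SC := SC_pos
  have hSZ : (0 : ℤ) < (SC : ℤ) := by exact_mod_cast (show 0 < SC by norm_num [SC])
  -- names
  set g : ℕ → ℝ := fun k => (gc.getD k 0 : ℝ) with hg
  set H : ℕ → ℕ → ℝ := fun k l => (get81 Hc k l : ℝ) with hH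
  set τ : ℕ → ℝ := fun k => (t.getD k 0 : ℝ) with hτ
  set sv : ℕ → ℝ := fun k => x k * SC - τ k with hsv
  have hsymN : ∀ k l : ℕ, k < 9 → l < 9 → H k l = H l k := by
    intro k l hk hl
    have := hsym ⟨k, hk⟩ ⟨l, hl⟩
    simp only [hH, this]
  have hMulR : ∀ k, ((hMul Hc t k : ℤ) : ℝ) = ∑ l ∈ range 9, H k l * τ l := fun k => by rw [hMul_cast]
  -- (1) the floor division
  unfold boxMin
  rw [q2_eq_sum, m2_eq_sum]
  have h2pos : (0 : ℤ) < 2 * (SC : ℤ) * (SC : ℤ) := by positivity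
  have hfloor := fdiv_le_div
    (a := (∑ k ∈ range 9, (2 * (SC : ℤ) * gc.getD k 0 * t.getD k 0 + t.getD k 0 * hMul Hc t k)) +
      ∑ k ∈ range 9, segMin ((SC : ℤ) * gc.getD k 0 + hMul Hc t k) (-κ) (-wf.getD k 0 - t.getD k 0) (wf.getD k 0 - t.getD k 0))
    (b := 2 * (SC : ℤ) * (SC : ℤ)) h2pos
  refine (div_le_div_of_nonneg_right hfloor hS.le).trans ?_
  -- (2) real inequality: `(q2 + m2) / (2 SC²) / SC ≤ RHS`, i.e. `q2 + m2 ≤ RHS · (2 SC² · SC)`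
  have h2S : (0 : ℝ) < ((2 * (SC : ℤ) * (SC : ℤ) : ℤ) : ℝ) := by exact_mod_cast h2pos
  rw [div_div, div_le_iff₀ (mul_pos h2S hS)]
  push_cast
  simp only [hMulR]
  -- per-coordinate `segMin` bounds
  have hseg : ∀ k ∈ range 9, ((segMin ((SC : ℤ) * gc.getD k 0 + hMul Hc t k) (-κ) (-wf.getD k 0 - t.getD k 0) (wf.getD k 0 - t.getD k 0) : ℤ) : ℝ) ≤
      2 * ((SC : ℝ) * g k + ∑ l ∈ range 9, H k l * τ l) * sv k + (-(κ : ℝ)) * sv k ^ 2 := by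
    intro k hk
    have hk9 : k < 9 := Finset.mem_range.mp hk
    have hxk := abs_le.mp (hx k hk9)
    have hlow : -(wf.getD k 0 : ℝ) ≤ x k * SC := by
      have h := mul_le_mul_of_nonneg_right hxk.1 hS.le
      rwa [neg_mul, div_mul_cancel₀ _ hS.ne'] at h
    have hupp : x k * SC ≤ (wf.getD k 0 : ℝ) := by
      have h := mul_le_mul_of_nonneg_right hxk.2 hS.le
      rwa [div_mul_cancel₀ _ hS.ne'] at h
    have h1 : ((-wf.getD k 0 - t.getD k 0 : ℤ) : ℝ) ≤ sv k := by push_cast; simp only [hsv, hτ]; linarith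
    have h2 : sv k ≤ ((wf.getD k 0 - t.getD k 0 : ℤ) : ℝ) := by push_cast; simp only [hsv, hτ]; linarith
    have := segMin_le (A := (SC : ℤ) * gc.getD k 0 + hMul Hc t k) (D := -κ) h1 h2
    have hA : (((SC : ℤ) * gc.getD k 0 + hMul Hc t k : ℤ) : ℝ) = (SC : ℝ) * g k + ∑ l ∈ range 9, H k l * τ l := by
      push_cast; rw [hMulR]
    rw [hA] at this
    push_cast at this
    exact this
  have hm2 := Finset.sum_le_sum hseg
  -- PSD shift on the deviation `sv`
  have hpsdR := shifted_form_nonneg hsym hpsd sv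
  have hsplit : ∑ k ∈ range 9, ∑ l ∈ range 9, ((get81 Hc k l : ℝ) + (if k = l then (κ : ℝ) else 0)) * (sv k * sv l) =
      ∑ k ∈ range 9, ∑ l ∈ range 9, H k l * (sv k * sv l) + (κ : ℝ) * ∑ k ∈ range 9, sv k ^ 2 := by
    simp only [add_mul, Finset.sum_add_distrib, hH]
    congr 1
    rw [Finset.mul_sum]
    refine Finset.sum_congr rfl fun k hk => ?_
    rw [Finset.sum_eq_single_of_mem k hk (fun l _ hne => by rw [if_neg (Ne.symm hne), zero_mul])]
    simp [sq]
  have hss : -(κ : ℝ) * ∑ k ∈ range 9, sv k ^ 2 ≤ ∑ k ∈ range 9, ∑ l ∈ range 9, H k l * (sv k * sv l) := by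
    rw [hsplit] at hpsdR; linarith
  -- symmetric cross term
  have hcross : ∑ k ∈ range 9, ∑ l ∈ range 9, H k l * (τ k * sv l) = ∑ k ∈ range 9, ∑ l ∈ range 9, H k l * (τ l * sv k) := by
    rw [Finset.sum_comm]
    refine Finset.sum_congr rfl fun k hk => Finset.sum_congr rfl fun l hl => ?_
    rw [hsymN l k (Finset.mem_range.mp hl) (Finset.mem_range.mp hk)]
  -- expand RHS with `x k = (τ k + sv k)/SC`
  have e1 : ∀ k, x k = (τ k + sv k) / SC := fun k => by simp only [hsv]; field_simp; ring
  have main : (∑ k ∈ range 9, g k / SC * x k + 1 / 2 * ∑ k ∈ range 9, ∑ l ∈ range 9, H k l / SC * (x k * x l)) * (2 * SC * SC * SC) =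
      (∑ k ∈ range 9, (2 * SC * g k * τ k + τ k * ∑ l ∈ range 9, H k l * τ l)) +
      (∑ k ∈ range 9, (2 * (SC * g k + ∑ l ∈ range 9, H k l * τ l) * sv k)) +
      ∑ k ∈ range 9, ∑ l ∈ range 9, H k l * (sv k * sv l) := by
    -- both sides as `LIN + QUAD` pieces
    have lin : (∑ k ∈ range 9, g k / SC * x k) * (2 * SC * SC * SC) = ∑ k ∈ range 9, (2 * SC * g k * τ k + 2 * SC * g k * sv k) := by
      rw [Finset.sum_mul]
      refine Finset.sum_congr rfl fun k _ => ?_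
      rw [e1 k]; field_simp
    have quad : (1 / 2 * ∑ k ∈ range 9, ∑ l ∈ range 9, H k l / SC * (x k * x l)) * (2 * SC * SC * SC) =
        ∑ k ∈ range 9, ∑ l ∈ range 9, (H k l * (τ k * τ l) + H k l * (τ k * sv l) + H k l * (τ l * sv k) + H k l * (sv k * sv l)) := by
      rw [mul_comm, ← mul_assoc, Finset.mul_sum]
      refine Finset.sum_congr rfl fun k _ => ?_
      rw [Finset.mul_sum]
      refine Finset.sum_congr rfl fun l _ => ?_
      rw [e1 k, e1 l]; field_simp; ring
    rw [add_mul, lin, quad]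
    simp only [Finset.sum_add_distrib]
    rw [hcross]
    have hq : ∀ k ∈ range 9, τ k * ∑ l ∈ range 9, H k l * τ l = ∑ l ∈ range 9, H k l * (τ k * τ l) := by
      intro k _; rw [Finset.mul_sum]; exact Finset.sum_congr rfl fun l _ => by ring
    have hc2 : ∀ k ∈ range 9, 2 * (SC * g k + ∑ l ∈ range 9, H k l * τ l) * sv k = 2 * SC * g k * sv k + 2 * ∑ l ∈ range 9, H k l * (τ l * sv k) := by
      intro k _
      have : ∑ l ∈ range 9, H k l * (τ l * sv k) = (∑ l ∈ range 9, H k l * τ l) * sv k := by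
        rw [Finset.sum_mul]; exact Finset.sum_congr rfl fun l _ => by ring
      rw [this]; ring
    rw [Finset.sum_congr rfl hq, Finset.sum_congr rfl hc2, Finset.sum_add_distrib, ← Finset.mul_sum]
    ring
  have hm2' : ∑ k ∈ range 9, ((segMin ((SC : ℤ) * gc.getD k 0 + hMul Hc t k) (-κ) (-wf.getD k 0 - t.getD k 0) (wf.getD k 0 - t.getD k 0) : ℤ) : ℝ) ≤
      ∑ k ∈ range 9, 2 * (SC * g k + ∑ l ∈ range 9, H k l * τ l) * sv k - (κ : ℝ) * ∑ k ∈ range 9, sv k ^ 2 := by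
    refine hm2.trans (le_of_eq ?_)
    rw [Finset.mul_sum, ← Finset.sum_sub_distrib]
    refine Finset.sum_congr rfl fun k _ => ?_; ring
  have hgoal : (∑ k ∈ range 9, (2 * SC * g k * τ k + τ k * ∑ l ∈ range 9, H k l * τ l)) +
      ∑ k ∈ range 9, ((segMin ((SC : ℤ) * gc.getD k 0 + hMul Hc t k) (-κ) (-wf.getD k 0 - t.getD k 0) (wf.getD k 0 - t.getD k 0) : ℤ) : ℝ) ≤
      (∑ k ∈ range 9, g k / SC * x k + 1 / 2 * ∑ k ∈ range 9, ∑ l ∈ range 9, H k l / SC * (x k * x l)) * (2 * SC * SC * SC) := by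
    rw [main]; linarith
  convert hgoal using 2

end Summit.AtomisticToContinuum.Crystallization.Theorems.FrustratedLawDichotomyStrainedPatchHomValueT2Kit
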